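import Summits.BirchSwinnertonDyer.BirchSwinnertonDyer.Theses.PAdicOrderV2
import Literature.NumberTheory.EllipticCurves.PAdicBSDInterpolationProofs
import Literature.NumberTheory.EllipticCurves.LeadingTermPPartProofs
import Literature.NumberTheory.EllipticCurves.AnalyticRankOrderProofs
import Literature.NumberTheory.EllipticCurves.SupersingularDensitySerreFrobeniusProofs
import Literature.NumberTheory.EllipticCurves.CuspFormLFunctionAnalyticRankProofs

/-!
# BirchSwinnertonDyer / PAdicOrderV2 — crux `PAdicOrderThesisR2` (stmt-0487), line `Sketch`,
# stub `stub_UB_rank0`: `r_an(E) = 0 ⇒ ord_{T=0} L_p(E, T) = 0` at every good ordinary prime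

Registered stub of the Kato-sandwich skeleton (`Cruxes/PAdicOrderThesisR2/Lines/Sketch.lean`):
for `E/ℚ` (globally minimal `W`), a good ordinary prime `p` and the newform `f` of `E`, if the
analytic rank vanishes then the unit-root `p`-adic `L`-function
`L_p(E, T) = padicLFunction f (unitRoot W p)` does not vanish at `T = 0`, i.e. its
`PowerSeries.order` is `0`.

Proof (Mazur–Tate–Teitelbaum 1986, §I.14, (14.3) at the trivial character): the constant term is
`L_p(E, 0) = (1 - α⁻¹)² [0]⁺_f` (`constantCoeff_padicLFunction_unitRoot`, the tree's PROVED
interpolation theorem), where `[0]⁺_f · Ω⁺_f = L(E, 1)` (`IsNewformOf.entireLFunction_one_eq`),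
so `[0]⁺_f ≠ 0` when `L(E, 1) ≠ 0`, which is `r_an(E) = 0` (`analyticRank_eq_zero_iff_holds`,
`L(E, s)` being entire for a modular `E`, `IsNewformOf.hasEntireLFunction`); and `α ≠ 1` because
`α = 1` would force `a_p = p + 1`, against Hasse's bound `a_p² ≤ 4p`
(`WeierstrassCurve.frobeniusTrace_sq_le_four_mul`). Everything used is proved in the tree; the
stub is unconditional.
-/

-- single-conjunct summit: `Summit.BirchSwinnertonDyer.BirchSwinnertonDyer.…` repeats the name by design
set_option linter.dupNamespace false

namespace Summit.BirchSwinnertonDyer.BirchSwinnertonDyer.Cruxes.PAdicOrderThesisR2.KatoSandwich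

open Literature.NumberTheory.EllipticCurves Literature.NumberTheory.EllipticCurves.ModularForms

/-- **The unit root is not `1`.** At a good ordinary prime `p` of `E/ℚ` (globally minimal `W`),
the unit root `α` of `X² - a_p X + p` satisfies `α ≠ 1` in `ℚ_p`: otherwise `1 - a_p + p = 0`,
i.e. `a_p = p + 1`, contradicting Hasse's bound `a_p² ≤ 4p` (Silverman, *AEC* Thm. V.1.1;
equivalently `#Ẽ(𝔽_p) ≠ 0`). This is the non-vanishing of the Euler-type factor `(1 - α⁻¹)²`
of the Mazur–Tate–Teitelbaum interpolation formula at a good (non-exceptional) prime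
(Mazur–Tate–Teitelbaum 1986, §I.14). [cite: MazurTateTeitelbaum1986Invent, §I.14] -/
theorem unitRoot_coe_ne_one (W : WeierstrassCurve ℚ) [W.IsElliptic] [W.IsGloballyMinimal]
    (p : ℕ) [Fact p.Prime] (hord : IsOrdinaryAt W p) : (unitRoot W p : ℚ_[p]) ≠ 1 := by
  intro h1
  obtain ⟨hαeq, -, -⟩ := unitRoot_coe_spec (W := W) hord
  rw [h1] at hαeq
  have hap : ((W.frobeniusTrace p : ℤ) : ℚ_[p]) = (p : ℚ_[p]) + 1 := by
    linear_combination -hαeq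
  have hapZ : W.frobeniusTrace p = (p : ℤ) + 1 := by exact_mod_cast hap
  have hH : W.frobeniusTrace p ^ 2 ≤ 4 * p := W.frobeniusTrace_sq_le_four_mul p hord.1
  rw [hapZ] at hH
  have hp2 : (2 : ℤ) ≤ (p : ℤ) := by exact_mod_cast (Fact.out : p.Prime).two_le
  nlinarith

/-- **`L(E, 1) ≠ 0 ⇒ L_p(E, 0) ≠ 0`.** At a good ordinary prime `p`, for the newform `f` of `E/ℚ`
(globally minimal `W`), if `L(E, 1) ≠ 0` then the constant term of
`L_p(E, T) = padicLFunction f (unitRoot W p)` is non-zero: it equals `(1 - α⁻¹)² [0]⁺_f`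
(Mazur–Tate–Teitelbaum 1986, §I.14, (14.3); tree theorem `constantCoeff_padicLFunction_unitRoot`)
with `α ≠ 1` (`unitRoot_coe_ne_one`) and `[0]⁺_f · Ω⁺_f = L(E, 1)`
(`IsNewformOf.entireLFunction_one_eq`, MTT §I.8 (8.6)). [cite: MazurTateTeitelbaum1986Invent, §I.14 (14.3)] -/
theorem constantCoeff_padicLFunction_ne_zero_of_entireLFunction_one_ne_zero
    (W : WeierstrassCurve ℚ) [W.IsElliptic] [W.IsGloballyMinimal] (p : ℕ) [Fact p.Prime]
    (hord : IsOrdinaryAt W p) {N : ℕ} [NeZero N] {f : CuspForm (CongruenceSubgroup.Gamma0 N) 2}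
    (hf : IsNewformOf W f) (hL : W.entireLFunction 1 ≠ 0) :
    PowerSeries.constantCoeff (padicLFunction f (unitRoot W p : ℚ_[p])) ≠ 0 := by
  have hsym : (ratPlusSymbol f 0 : ℚ) ≠ 0 := by
    intro h
    apply hL
    rw [hf.entireLFunction_one_eq, h]
    simp
  have hα1 : (unitRoot W p : ℚ_[p]) ≠ 1 := unitRoot_coe_ne_one W p hord
  have hfac : (1 : ℚ_[p]) - (unitRoot W p : ℚ_[p])⁻¹ ≠ 0 := by
    intro h
    apply hα1
    have h' : (unitRoot W p : ℚ_[p])⁻¹ = 1 := (sub_eq_zero.mp h).symm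
    exact inv_eq_one.mp h'
  rw [constantCoeff_padicLFunction_unitRoot hord hf]
  exact mul_ne_zero (pow_ne_zero _ hfac) (by exact_mod_cast hsym)

/-- **Stub `stub_UB_rank0` of line `Sketch` (crux `PAdicOrderThesisR2`, stmt-0487): in analytic
rank `0`, `ord_{T=0} L_p(E, T) = 0` at every good ordinary prime.** For `E/ℚ` (globally minimal
`W`), `p` good ordinary, `f` the newform of `E`: `r_an(E) = 0 ⇒ (padicLFunction f α_p).order = 0`.
`r_an = 0 ⇔ L(E, 1) ≠ 0` (`analyticRank_eq_zero_iff_holds`; `L(E, s)` is entire since `E` has the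
newform `f`, `IsNewformOf.hasEntireLFunction`), and then the constant term of `L_p(E, T)` is
non-zero (`constantCoeff_padicLFunction_ne_zero_of_entireLFunction_one_ne_zero`), so the order of
the power series is `0` (`PowerSeries.order_eq_nat`). This is the `r = 0` case of the
Mazur–Tate–Teitelbaum conjecture `ord_{T=0} L_p(E, T) = r_an(E)`, known by interpolation
(Mazur–Tate–Teitelbaum 1986, §I.14 and §II.10). [cite: MazurTateTeitelbaum1986Invent, §I.14 (14.3)] -/
theorem stub_UB_rank0 :
    ∀ (W : WeierstrassCurve ℚ) [W.IsElliptic] [W.IsGloballyMinimal] (p : ℕ) [Fact p.Prime],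
      IsOrdinaryAt W p → W.analyticRank = 0 →
        ∀ {N : ℕ} [NeZero N] (f : CuspForm (CongruenceSubgroup.Gamma0 N) 2), IsNewformOf W f →
          (padicLFunction f (unitRoot W p : ℚ_[p])).order = 0 := by
  intro W _ _ p _ hord h0 N _ f hf
  have hL : W.entireLFunction 1 ≠ 0 :=
    (W.analyticRank_eq_zero_iff_holds hf.hasEntireLFunction).mp h0
  have hc := constantCoeff_padicLFunction_ne_zero_of_entireLFunction_one_ne_zero W p hord hf hL
  rw [← PowerSeries.coeff_zero_eq_constantCoeff_apply] at hc
  have h : (padicLFunction f (unitRoot W p : ℚ_[p])).order = (0 : ℕ) :=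
    PowerSeries.order_eq_nat.mpr ⟨hc, fun i hi ↦ absurd hi (Nat.not_lt_zero i)⟩
  simpa using h

end Summit.BirchSwinnertonDyer.BirchSwinnertonDyer.Cruxes.PAdicOrderThesisR2.KatoSandwich

/-! ### The sandwich closed modulo its open stubs, and the analytic-rank-0 sector (appended 2026-08-16)

What the registered skeleton `Cruxes/PAdicOrderThesisR2/Lines/Sketch.lean` (line `Sketch`, idea
`kato-sandwich-one-prime`) proves today, sorry-free:

* `padicOrder_eq_and_eq_of_analyticRank_eq_zero` — **the rank-0 sector, per curve and per
  prime**: if `r_an(E) = 0` then at EVERY odd good ordinary prime `p`, for the newform `f` of `E`,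
  `ord_T L_p = r_an = 0` (`stub_UB_rank0` above) and `ord_T L_p = r_MW` GIVEN Kato's inequality
  `r_MW ≤ ord_T L_p` at `(W, p, f)` (Kato 2004, Thm 18.4; the named fact
  `kato_mordellWeilRank_le_order_padicLFunction`, = route item `PAdicOrderKatoSideR2`, stmt-0491).
  So in rank 0 both Mazur–Tate–Teitelbaum equalities hold at every odd good ordinary prime,
  conditionally on Kato's bound alone (which here plays the part of Kolyvagin's `r_MW = 0`).
* `padicOrderThesisR2_of_sandwich` — **X = `PAdicOrderThesisR2` from the five remaining stubs**
  of the line, stated with their registered signatures: modularity (inlined as in the route glue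
  `CruxesToThesis`), the Kato side `PAdicOrderKatoSideR2`, `OnePrimeUB` in positive analytic rank
  (`∃` good ordinary `p ≥ 5` with `ord_T L_p ≤ r_an`), and the classical lower bound `r_an ≤ r_MW`
  split as rank `1` (Gross–Zagier–Kolyvagin) and rank `≥ 2`. Composition: rank 0 by the first
  theorem at a prime from `exists_good_ordinary_prime_holds`; rank ≥ 1 by `r_MW ≤ ord ≤ r_an ≤ r_MW`.

Status of the hypotheses (2026-08-16): modularity = cite-only fact
`ModularForms.exists_isNewformOf` (BCDT 2001); Kato side = undischarged fact
`kato_mordellWeilRank_le_order_padicLFunction` (reduced in tree to `kato_divisibility`);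
LB rank 1 = undischarged fact `rank_eq_analyticRank_of_analyticRank_le_one` (reduced in tree to
modularity + Waldspurger + Murty–Murty + Gross–Zagier + Heegner points + Kolyvagin; conditional
stub `stub_LB_rank1_of_rank_eq_analyticRank` in `…StubLBRank1.lean`); LB rank ≥ 2 and OnePrimeUB
in positive rank are OPEN (the latter is, in rank 1, the existence of one ordinary prime at which
the cyclotomic `p`-adic height of a generator is non-zero — `PAdicHeightBarrier`). -/

namespace Summit.BirchSwinnertonDyer.BirchSwinnertonDyer.Cruxes.PAdicOrderThesisR2.KatoSandwich

open Literature.NumberTheory.EllipticCurves Literature.NumberTheory.EllipticCurves.ModularForms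

/-- **`r_an(E) ≠ 0 ⇒ L_p(E, 0) = 0`** at a good ordinary prime, for the newform `f` of `E/ℚ`
(globally minimal `W`): if the analytic rank is positive then `L(E, 1) = 0`
(`analyticRank_eq_zero_iff_holds`), hence `[0]⁺_f = 0` (`[0]⁺_f · Ω⁺_f = re L(E, 1)` with
`Ω⁺_f > 0`, `IsNewformOf.ratPlusSymbol_zero_mul_plusPeriod`, `IsNewform0.plusPeriod_pos_holds`), so
the constant term `(1 - α⁻¹)² [0]⁺_f` of `L_p(E, T)` vanishes (Mazur–Tate–Teitelbaum 1986, §I.14,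
(14.3); this is the "`≥ 1`" half of the rank-one case, known by interpolation).
[cite: MazurTateTeitelbaum1986Invent, §I.14 (14.3)] -/
theorem constantCoeff_padicLFunction_eq_zero_of_analyticRank_ne_zero (W : WeierstrassCurve ℚ)
    [W.IsElliptic] [W.IsGloballyMinimal] (p : ℕ) [Fact p.Prime] (hord : IsOrdinaryAt W p)
    {N : ℕ} [NeZero N] {f : CuspForm (CongruenceSubgroup.Gamma0 N) 2} (hf : IsNewformOf W f)
    (h : W.analyticRank ≠ 0) :
    PowerSeries.constantCoeff (padicLFunction f (unitRoot W p : ℚ_[p])) = 0 := by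
  have hL : W.entireLFunction 1 = 0 := by
    by_contra hne
    exact h ((W.analyticRank_eq_zero_iff_holds hf.hasEntireLFunction).mpr hne)
  have hsym : ratPlusSymbol f 0 = 0 := by
    have hpos : 0 < plusPeriod f := IsNewform0.plusPeriod_pos_holds hf.1 hf.coeffField_eq_bot
    have h1 := hf.ratPlusSymbol_zero_mul_plusPeriod
    rw [hL, Complex.zero_re] at h1
    have h2 : ((ratPlusSymbol f 0 : ℚ) : ℝ) = 0 := (mul_eq_zero.mp h1).resolve_right hpos.ne'
    exact_mod_cast h2
  rw [constantCoeff_padicLFunction_unitRoot hord hf, hsym, Rat.cast_zero, mul_zero]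

/-- **`r_an(E) ≠ 0 ⇒ ord_{T=0} L_p(E, T) ≥ 1`** at a good ordinary prime (the `PowerSeries.order`
form of `constantCoeff_padicLFunction_eq_zero_of_analyticRank_ne_zero`; Mazur–Tate–Teitelbaum 1986,
§I.14 and §II.10: the `p`-adic `L`-function vanishes at `T = 0` whenever `L(E, 1) = 0`).
[cite: MazurTateTeitelbaum1986Invent, §I.14 (14.3)] -/
theorem one_le_order_padicLFunction_of_analyticRank_ne_zero (W : WeierstrassCurve ℚ)
    [W.IsElliptic] [W.IsGloballyMinimal] (p : ℕ) [Fact p.Prime] (hord : IsOrdinaryAt W p)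
    {N : ℕ} [NeZero N] {f : CuspForm (CongruenceSubgroup.Gamma0 N) 2} (hf : IsNewformOf W f)
    (h : W.analyticRank ≠ 0) :
    (1 : ℕ∞) ≤ (padicLFunction f (unitRoot W p : ℚ_[p])).order := by
  refine PowerSeries.nat_le_order _ 1 fun i hi ↦ ?_
  obtain rfl : i = 0 := by omega
  rw [PowerSeries.coeff_zero_eq_constantCoeff_apply]
  exact constantCoeff_padicLFunction_eq_zero_of_analyticRank_ne_zero W p hord hf h

/-- **Rank-0 comparison, both directions: `ord_{T=0} L_p(E, T) = 0 ↔ r_an(E) = 0`** at every good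
ordinary prime `p`, for the newform `f` of `E/ℚ` (globally minimal `W`). This is the analytic-rank-0
case of the Mazur–Tate–Teitelbaum comparison `ord_{T=0} L_p = ord_{s=1} L` (route crux
`PAdicOrderComparisonR2` restricted to `r_an = 0` or `ord = 0`), a theorem by interpolation:
`L_p(E, 0) = (1 - α⁻¹)² L(E, 1)/Ω⁺` with `α ≠ 1` (Mazur–Tate–Teitelbaum 1986, §I.14 (14.3), §II.10).
[cite: MazurTateTeitelbaum1986Invent, §I.14 (14.3) and §II.10] -/
theorem order_padicLFunction_eq_zero_iff_analyticRank_eq_zero (W : WeierstrassCurve ℚ)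
    [W.IsElliptic] [W.IsGloballyMinimal] (p : ℕ) [Fact p.Prime] (hord : IsOrdinaryAt W p)
    {N : ℕ} [NeZero N] {f : CuspForm (CongruenceSubgroup.Gamma0 N) 2} (hf : IsNewformOf W f) :
    (padicLFunction f (unitRoot W p : ℚ_[p])).order = 0 ↔ W.analyticRank = 0 := by
  refine ⟨fun h ↦ ?_, fun h0 ↦ stub_UB_rank0 W p hord h0 f hf⟩
  by_contra hne
  have h1 := one_le_order_padicLFunction_of_analyticRank_ne_zero W p hord hf hne
  rw [h] at h1
  exact absurd h1 (by decide)

/-- **Rank-0 sector of the Mazur–Tate–Teitelbaum rank conjecture, at every odd good ordinary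
prime, modulo Kato's bound.** Let `E/ℚ` have globally minimal model `W` and analytic rank `0`,
let `p ≠ 2` be a good ordinary prime and `f` the newform of `E`. If Kato's inequality
`rank E(ℚ) ≤ ord_{T=0} L_p(E, T)` holds at `(W, p, f)` (K. Kato, Astérisque 295 (2004), Thm 18.4
— the named fact `kato_mordellWeilRank_le_order_padicLFunction W p`), then
`ord_{T=0} L_p(f, α_p, T) = r_an(E)` and `ord_{T=0} L_p(f, α_p, T) = r_MW(E)` (both `= 0`):
the order is `0` by interpolation (`stub_UB_rank0`: `L_p(E, 0) = (1 - α⁻¹)² L(E, 1)/Ω⁺ ≠ 0`,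
Mazur–Tate–Teitelbaum 1986, §I.14 (14.3)), and `r_MW ≤ 0` by Kato.
[cite: MazurTateTeitelbaum1986Invent, §I.14 (14.3) and §II.10] -/
theorem padicOrder_eq_and_eq_of_analyticRank_eq_zero (W : WeierstrassCurve ℚ) [W.IsElliptic]
    [W.IsGloballyMinimal] (p : ℕ) [Fact p.Prime] (hp : p ≠ 2) (hord : IsOrdinaryAt W p)
    {N : ℕ} [NeZero N] (f : CuspForm (CongruenceSubgroup.Gamma0 N) 2) (hf : IsNewformOf W f)
    (hkato : kato_mordellWeilRank_le_order_padicLFunction W p (f := f))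
    (h0 : W.analyticRank = 0) :
    (padicLFunction f (unitRoot W p : ℚ_[p])).order = W.analyticRank ∧
      (padicLFunction f (unitRoot W p : ℚ_[p])).order = W.mordellWeilRank := by
  have hub : (padicLFunction f (unitRoot W p : ℚ_[p])).order = 0 := stub_UB_rank0 W p hord h0 f hf
  have hk : (W.mordellWeilRank : ℕ∞) ≤ (padicLFunction f (unitRoot W p : ℚ_[p])).order :=
    hkato hp hord hf
  refine ⟨by rw [hub, h0, Nat.cast_zero], le_antisymm ?_ hk⟩
  rw [hub]
  exact zero_le

/-- **The crux `PAdicOrderThesisR2` (route `PAdicOrderV2`) from the open stubs of the Kato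
sandwich** (line `Sketch`, idea `kato-sandwich-one-prime`), each hypothesis being a registered stub
of the skeleton with its exact signature:
* `hmod` — modularity, inlined as in `CruxesToThesis` (Breuil–Conrad–Diamond–Taylor 2001, Thm A;
  = `ModularForms.exists_isNewformOf`);
* `hkato` — the route support item `PAdicOrderKatoSideR2` (Kato 2004, Thm 18.4);
* `hUB` — `OnePrimeUB` in positive analytic rank: some good ordinary `p ≥ 5` with
  `ord_T L_p(f, α_p, T) ≤ r_an` for every newform `f` of `E`;
* `hLB1` — `r_an = 1 ⇒ 1 ≤ r_MW` (Gross–Zagier 1986, Kolyvagin 1990);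
* `hLB2` — `2 ≤ r_an ⇒ r_an ≤ r_MW` (lower-bound half of BSD, open).
Proof: take the newform `f` of level `N_W` (`hmod`, `NeZero N_W` by `conductorNorm_pos_holds`).
In analytic rank `0`, at any good ordinary `p ≥ 5` (`exists_good_ordinary_prime_holds`) both
equalities hold by `padicOrder_eq_and_eq_of_analyticRank_eq_zero`. In positive rank, at the prime
of `hUB`: `r_MW ≤ ord` (`hkato`) `≤ r_an` (`hUB`) `≤ r_MW` (`hLB1`/`hLB2`), so all three agree.
[cite: MazurTateTeitelbaum1986Invent, §II.10] -/
theorem padicOrderThesisR2_of_sandwich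
    (hmod : ∀ (W : WeierstrassCurve ℚ) [W.IsElliptic] [NeZero (W.conductorNorm ℤ)],
      ∃ f : CuspForm (CongruenceSubgroup.Gamma0 (W.conductorNorm ℤ)) 2, IsNewformOf W f)
    (hkato : Theses.PAdicOrderV2.PAdicOrderKatoSideR2)
    (hUB : ∀ (W : WeierstrassCurve ℚ) [W.IsElliptic] [W.IsGloballyMinimal], 0 < W.analyticRank →
      ∃ (p : ℕ) (_ : Fact p.Prime), 5 ≤ p ∧ IsOrdinaryAt W p ∧
        ∀ {N : ℕ} [NeZero N] (f : CuspForm (CongruenceSubgroup.Gamma0 N) 2), IsNewformOf W f →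
          (padicLFunction f (unitRoot W p : ℚ_[p])).order ≤ (W.analyticRank : ℕ∞))
    (hLB1 : ∀ (W : WeierstrassCurve ℚ) [W.IsElliptic] [W.IsGloballyMinimal],
      W.analyticRank = 1 → 1 ≤ W.mordellWeilRank)
    (hLB2 : ∀ (W : WeierstrassCurve ℚ) [W.IsElliptic] [W.IsGloballyMinimal],
      2 ≤ W.analyticRank → W.analyticRank ≤ W.mordellWeilRank) :
    Theses.PAdicOrderV2.PAdicOrderThesisR2 := by
  intro W _ _
  haveI hN : NeZero (W.conductorNorm ℤ) := ⟨(W.conductorNorm_pos_holds).ne'⟩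
  obtain ⟨f, hf⟩ := hmod W
  rcases Nat.eq_zero_or_pos W.analyticRank with h0 | hpos
  · obtain ⟨p, hp, h5, hgood, hord⟩ := WeierstrassCurve.exists_good_ordinary_prime_holds W
    have hO : IsOrdinaryAt W p := ⟨hgood, hord⟩
    exact ⟨p, hp, hO, W.conductorNorm ℤ, hN, f, hf,
      padicOrder_eq_and_eq_of_analyticRank_eq_zero W p (by omega) hO f hf
        (fun hp2 hO' hf' ↦ hkato W p hp2 hO' f hf') h0⟩
  · obtain ⟨p, hp, h5, hO, hub⟩ := hUB W hpos
    have hLB : W.analyticRank ≤ W.mordellWeilRank := by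
      rcases Nat.lt_or_ge W.analyticRank 2 with h1 | h2
      · have h1' : W.analyticRank = 1 := by omega
        rw [h1']
        exact hLB1 W h1'
      · exact hLB2 W h2
    have h1 : (W.mordellWeilRank : ℕ∞) ≤ (padicLFunction f (unitRoot W p : ℚ_[p])).order :=
      hkato W p (by omega) hO f hf
    have h2 : (padicLFunction f (unitRoot W p : ℚ_[p])).order ≤ (W.analyticRank : ℕ∞) := hub f hf
    have h3 : (W.analyticRank : ℕ∞) ≤ (W.mordellWeilRank : ℕ∞) := by exact_mod_cast hLB
    exact ⟨p, hp, hO, W.conductorNorm ℤ, hN, f, hf, le_antisymm h2 (h3.trans h1),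
      le_antisymm (h2.trans h3) h1⟩

end Summit.BirchSwinnertonDyer.BirchSwinnertonDyer.Cruxes.PAdicOrderThesisR2.KatoSandwich
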